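import Summits.BirchSwinnertonDyer.BirchSwinnertonDyer.Theorems.PrintCf2SplitBadTwoCMPrimaryDyadicValueFrame
import Literature.NumberTheory.EllipticCurves.InertiaTameFactorizationProofs
import HarnessLib

/-!
# Crux `PrintCf2.SplitBadTwoRankOneOfFacts` (stmt-BirchSwinnertonDyer-20368), road α v10.3 — brick B15 file 5: UNRAMIFIED SQUARE ROOTS ABOVE `2` —
# inertia of `K_w` fixes `√u` for `u ≡ 1 (mod 4)`; an arithmetic Frobenius NEGATES `√u` for `u ≡ 5 (mod 8)` when `f(w|2) = 1`

Cell `bsd-print-cf2`, width seat `bsd-line-cf2-p1-w2` g9 (prover-bsd-line-cf2-p1-w2-g9-0); brick B15 (memo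
`Cruxes/SplitBadTwoRankOneOfFacts/B15-DYADIC-EXACT-w2g9.md` §3, the missing row (1,3) of the dyadic table); `--supports stmt-BirchSwinnertonDyer-20368`
(helper, Theses-free). HONEST FRAMING: nothing here closes the crux or a registered stub; BSD is not proved by any of this; no summit statement is proved
by this seat. No definition, no named fact, no `sorry`.

WHAT (LOCAL, any number field `K`, any place `w ∣ 2`, `F = K_w`, `res : Γ_F → Γ_K`, `√u = geomSqrt (u : K) ∈ K̄`, `𝔓 = absMaximalIdeal F`):
* §1 `two_mem_absMaximalIdeal`, `intCast_not_mem_absMaximalIdeal_of_odd` (`2 ∈ 𝔓`, odd integers are not in `𝔓`).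
* §2 **`smul_geomSqrt_eq_of_mem_absInertia_of_emod_four_eq_one`** — `u ≡ 1 (mod 4)`, `τ ∈ I_F` ⇒ `res τ • √u = √u`: `θ = (1 + √u)/2 ∈ \bar𝒪` is a
  root of `X² − X − (u−1)/4`; `τθ − θ ∈ 𝔓` (definition of inertia); if `τ√u = −√u` then `τθ − θ = −√u`, so `u = (√u)² ∈ 𝔓`, `u` odd — absurd.
* §3 **`smul_geomSqrt_eq_neg_of_isFrobPow_one_of_emod_eight_eq_five`** — `u ≡ 5 (mod 8)`, `#𝓀(F) = 2`, `φ` of Frobenius degree `1` ⇒ `res φ • √u = −√u`: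
  `φθ − θ² ∈ 𝔓` with `θ² = θ + c`, `c = (u−1)/4` ODD; if `φ√u = √u` then `φθ = θ` and `c ∈ 𝔓` — absurd (`X² + X + 1` is irreducible over `𝔽₂`:
  `√u` generates the unramified quadratic extension and Frobenius is non-trivial on it).
These are the two inputs («inertia fixes `√(−d)`, Frobenius negates it» for `−d ≡ 5 (8)`) that complete the dyadic table of the memo: `#W*(K_{v̄}) = 4` for
`d ≡ 3 (8)` and `#W*(K_v) = 2` for every member (file 6). presearch: Neukirch ANT II (7.12)–(7.13) (unramified extensions ↔ residue extensions),
Serre *Local Fields* I §8, Cox §5 (2 splits in ℚ(√u) iff u ≡ 1 (8)) — held; tree: `Rat.smul_geomSqrt_eq_of_mem_inertia_of_emod_four_eq_one` (the GLOBAL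
`Γ_ℚ`-inertia version, p63xxxx), `…TwistDyadicUnramifiedSqrt.closureEmb_geomSqrt_mem_maxUnramified_of_emod_eight_eq_five` (`K = ℚ` only); here LOCAL for
any number field in the `IsFrobPow`/`absInertia` currency of p657782. beyond-print theorem: no.

References: [NeukirchANT1999] Ch. II (7.12)–(7.13), Ch. I §8; [SerreLocalFields1979] Ch. I §8; [TateCorvallis1979] §1.4 (1.4.1).
-/

noncomputable section

open scoped Classical Pointwise

set_option linter.dupNamespace false
set_option autoImplicit false

namespace Summit.BirchSwinnertonDyer.BirchSwinnertonDyer.Theorems.PrintCf2.CMPrimes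

open WeierstrassCurve Literature.NumberTheory.EllipticCurves Literature.NumberTheory.GaloisRepresentations Field NumberField
  IsDedekindDomain WithZero Polynomial
open Literature.NumberTheory.GaloisRepresentations.IsNonarchimedeanLocalField
open ValuativeRel

variable {K : Type} [Field K] [NumberField K] (w : HeightOneSpectrum (𝓞 K))

/-! ## §1. `2 ∈ 𝔓`, odd integers `∉ 𝔓` -/

/-- At a place `w ∣ 2`, `2` lies in the maximal ideal `𝓂` of `𝒪[K_w]`. [folklore] -/
theorem two_mem_maximalIdeal_integer (h2 : ((2 : ℕ) : 𝓞 K) ∈ w.asIdeal) : (2 : 𝒪[w.adicCompletion K]) ∈ 𝓂[w.adicCompletion K] := by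
  rw [IsLocalRing.mem_maximalIdeal, mem_nonunits_iff, Valuation.Integer.not_isUnit_iff_valuation_lt_one,
    ← Valuation.vlt_one_iff (valuation (w.adicCompletion K)), Valuation.vlt_one_iff (Valued.v : Valuation (w.adicCompletion K) (WithZero (Multiplicative ℤ)))]
  have h2F : ((2 : 𝒪[w.adicCompletion K]) : w.adicCompletion K) = algebraMap K (w.adicCompletion K) 2 := by
    rw [map_ofNat]; rfl
  rw [h2F, WeierstrassCurve.valued_algebraMap_adicCompletion, show (2 : K) = algebraMap (𝓞 K) K ((2 : ℕ) : 𝓞 K) by push_cast; rfl,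
    HeightOneSpectrum.valuation_of_algebraMap]
  exact (HeightOneSpectrum.intValuation_lt_one_iff_mem _ _).mpr h2

/-- **`2 ∈ 𝔓 = absMaximalIdeal K_w`** at a place `w ∣ 2` (`𝔓 ⊇ 𝓂·\bar𝒪`). [folklore] -/
theorem two_mem_absMaximalIdeal (h2 : ((2 : ℕ) : 𝓞 K) ∈ w.asIdeal) :
    (2 : absIntegers 𝒪[w.adicCompletion K] (w.adicCompletion K)) ∈ absMaximalIdeal (w.adicCompletion K) := by
  change _ ∈ ((𝓂[w.adicCompletion K]).map (algebraMap 𝒪[w.adicCompletion K] (absIntegers 𝒪[w.adicCompletion K] (w.adicCompletion K)))).radical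
  refine Ideal.le_radical ?_
  have h := Ideal.mem_map_of_mem (algebraMap 𝒪[w.adicCompletion K] (absIntegers 𝒪[w.adicCompletion K] (w.adicCompletion K)))
    (two_mem_maximalIdeal_integer w h2)
  rwa [map_ofNat] at h

/-- **Odd integers are not in `𝔓`** (`𝔓 ∋ 2` is a proper ideal). [folklore] -/
theorem intCast_not_mem_absMaximalIdeal_of_odd (h2 : ((2 : ℕ) : 𝓞 K) ∈ w.asIdeal) {c : ℤ} (hc : Odd c) :
    ((c : ℤ) : absIntegers 𝒪[w.adicCompletion K] (w.adicCompletion K)) ∉ absMaximalIdeal (w.adicCompletion K) := by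
  intro h
  haveI := absMaximalIdeal_isMaximal_holds (w.adicCompletion K)
  obtain ⟨k, rfl⟩ := hc
  have h2k : ((2 * k : ℤ) : absIntegers 𝒪[w.adicCompletion K] (w.adicCompletion K)) ∈ absMaximalIdeal (w.adicCompletion K) := by
    push_cast
    exact Ideal.mul_mem_right _ _ (two_mem_absMaximalIdeal w h2)
  have h1 : (1 : absIntegers 𝒪[w.adicCompletion K] (w.adicCompletion K)) ∈ absMaximalIdeal (w.adicCompletion K) := by
    have := Ideal.sub_mem _ h h2k
    push_cast at this
    simpa using this
  exact (Ideal.ne_top_iff_one _).mp (Ideal.IsMaximal.ne_top inferInstance) h1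

/-! ## §2. Inertia fixes `√u` for `u ≡ 1 (mod 4)` -/

/-- The image `b = ι(√u) ∈ \bar K_w` of `√u ∈ K̄` squares to `u`. [folklore] -/
theorem absClosureEmbedding_geomSqrt_intCast_sq (u : ℤ) :
    absClosureEmbedding K (w.adicCompletion K) (WeierstrassCurve.geomSqrt ((u : ℤ) : K)) ^ 2 = (u : AlgebraicClosure (w.adicCompletion K)) := by
  rw [← map_pow, WeierstrassCurve.geomSqrt_sq, AlgHom.commutes, map_intCast]

/-- `θ = (1 + b)/2` and `b` are integral over `𝒪[K_w]` when `b² = u ≡ 1 (mod 4)`: `θ² − θ − (u−1)/4 = 0`, `b² − u = 0`. [folklore] -/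
theorem isIntegral_half_one_add_of_sq_eq {u : ℤ} (hu : u % 4 = 1) {b : AlgebraicClosure (w.adicCompletion K)}
    (hb : b ^ 2 = (u : AlgebraicClosure (w.adicCompletion K))) :
    _root_.IsIntegral 𝒪[w.adicCompletion K] ((1 + b) / 2) ∧ _root_.IsIntegral 𝒪[w.adicCompletion K] b ∧
      ((1 + b) / 2) ^ 2 = (1 + b) / 2 + (((u - 1) / 4 : ℤ) : AlgebraicClosure (w.adicCompletion K)) := by
  haveI : CharZero (w.adicCompletion K) := charZero_of_injective_algebraMap (algebraMap K (w.adicCompletion K)).injective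
  obtain ⟨c, hc⟩ : ∃ c : ℤ, u = 4 * c + 1 := ⟨(u - 1) / 4, by omega⟩
  have hc' : (u - 1) / 4 = c := by omega
  have hθ : ((1 + b) / 2) ^ 2 = (1 + b) / 2 + (c : AlgebraicClosure (w.adicCompletion K)) := by
    have h2 : (2 : AlgebraicClosure (w.adicCompletion K)) ≠ 0 := two_ne_zero
    field_simp
    have hb' : b ^ 2 = 4 * (c : AlgebraicClosure (w.adicCompletion K)) + 1 := by rw [hb, hc]; push_cast; ring
    linear_combination hb'
  refine ⟨?_, ?_, by rw [hc']; exact hθ⟩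
  · refine ⟨X ^ 2 - (X + C (c : 𝒪[w.adicCompletion K])), (monic_X_pow 2).sub_of_left ?_, ?_⟩
    · rw [degree_X_add_C, degree_X_pow]; norm_num
    · rw [eval₂_sub, eval₂_add, eval₂_pow, eval₂_X, eval₂_C, map_intCast, hθ]
      ring
  · refine ⟨X ^ 2 - C (u : 𝒪[w.adicCompletion K]), (monic_X_pow 2).sub_of_left ?_, ?_⟩
    · exact lt_of_le_of_lt degree_C_le (by rw [degree_X_pow]; norm_num)
    · rw [eval₂_sub, eval₂_pow, eval₂_X, eval₂_C, map_intCast, hb, sub_self]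

/-- The action of `τ ∈ Γ_{K_w}` on `b = ι√u` is `±b`, read off `res τ • √u = ±√u`. [folklore] -/
theorem smul_absClosureEmbedding_geomSqrt (u : K) (τ : absoluteGaloisGroup (w.adicCompletion K)) :
    τ • absClosureEmbedding K (w.adicCompletion K) (WeierstrassCurve.geomSqrt u) =
      absClosureEmbedding K (w.adicCompletion K) (absGaloisRestrict K (w.adicCompletion K) τ • WeierstrassCurve.geomSqrt u) :=
  (absGaloisRestrict_apply_smul K (w.adicCompletion K) τ (WeierstrassCurve.geomSqrt u)).symm

/-- **INERTIA OF `K_w` FIXES `√u` FOR `u ≡ 1 (mod 4)`** (`w ∣ 2`, any number field `K`): `K_w(√u)/K_w` is unramified. For `τ ∈ I_{K_w}`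
(`absInertia`), `res τ • √u = √u` in `K̄`. Proof: `θ = (1 + ι√u)/2 ∈ \bar𝒪` and `τθ − θ ∈ 𝔓`; if `τ` negated `√u` then `τθ − θ = −ι√u ∈ 𝔓`, hence
`u = (ι√u)² ∈ 𝔓` with `u` odd. [cite: NeukirchANT1999, Ch. II Prop. (7.12)] [cite: SerreLocalFields1979, Ch. I §8] -/
theorem smul_geomSqrt_eq_of_mem_absInertia_of_emod_four_eq_one (h2 : ((2 : ℕ) : 𝓞 K) ∈ w.asIdeal) {u : ℤ} (hu : u % 4 = 1)
    {τ : absoluteGaloisGroup (w.adicCompletion K)} (hτ : τ ∈ absInertia (w.adicCompletion K)) :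
    absGaloisRestrict K (w.adicCompletion K) τ • WeierstrassCurve.geomSqrt ((u : ℤ) : K) = WeierstrassCurve.geomSqrt ((u : ℤ) : K) := by
  haveI : CharZero (w.adicCompletion K) := charZero_of_injective_algebraMap (algebraMap K (w.adicCompletion K)).injective
  have hb : absClosureEmbedding K (w.adicCompletion K) (WeierstrassCurve.geomSqrt ((u : ℤ) : K)) ^ 2 =
      (u : AlgebraicClosure (w.adicCompletion K)) := absClosureEmbedding_geomSqrt_intCast_sq w u
  obtain ⟨hθint, hbint, -⟩ := isIntegral_half_one_add_of_sq_eq w hu hb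
  rcases smul_geomSqrt_eq_or (absGaloisRestrict K (w.adicCompletion K) τ) ((u : ℤ) : K) with h | hneg
  · exact h
  exfalso
  -- `τ • b = -b`
  have hτb : τ • absClosureEmbedding K (w.adicCompletion K) (WeierstrassCurve.geomSqrt ((u : ℤ) : K)) =
      -absClosureEmbedding K (w.adicCompletion K) (WeierstrassCurve.geomSqrt ((u : ℤ) : K)) := by
    rw [smul_absClosureEmbedding_geomSqrt, hneg, map_neg]
  -- the integral elements `θ = (1 + b)/2` and `b`
  let xθ : absIntegers 𝒪[w.adicCompletion K] (w.adicCompletion K) :=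
    ⟨(1 + absClosureEmbedding K (w.adicCompletion K) (WeierstrassCurve.geomSqrt ((u : ℤ) : K))) / 2, hθint⟩
  let yb : absIntegers 𝒪[w.adicCompletion K] (w.adicCompletion K) :=
    ⟨absClosureEmbedding K (w.adicCompletion K) (WeierstrassCurve.geomSqrt ((u : ℤ) : K)), hbint⟩
  have hmem := (mem_absInertia_iff.mp hτ) xθ
  -- `τ • θ − θ = −b`
  have hval : τ • xθ - xθ = -yb := by
    apply Subtype.ext
    change τ • ((1 + absClosureEmbedding K (w.adicCompletion K) (WeierstrassCurve.geomSqrt ((u : ℤ) : K))) / 2) -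
        (1 + absClosureEmbedding K (w.adicCompletion K) (WeierstrassCurve.geomSqrt ((u : ℤ) : K))) / 2 =
      -absClosureEmbedding K (w.adicCompletion K) (WeierstrassCurve.geomSqrt ((u : ℤ) : K))
    rw [absoluteGaloisGroup.smul_def, map_div₀, map_add, map_one, map_ofNat, ← absoluteGaloisGroup.smul_def, hτb]
    ring
  rw [hval, neg_mem_iff] at hmem
  -- hence `u = b² ∈ 𝔓`, absurd since `u` is odd
  have hu2 : yb * yb = ((u : ℤ) : absIntegers 𝒪[w.adicCompletion K] (w.adicCompletion K)) := by
    apply Subtype.ext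
    change absClosureEmbedding K (w.adicCompletion K) (WeierstrassCurve.geomSqrt ((u : ℤ) : K)) *
        absClosureEmbedding K (w.adicCompletion K) (WeierstrassCurve.geomSqrt ((u : ℤ) : K)) = _
    rw [← sq, hb]; push_cast; rfl
  have hmem2 : ((u : ℤ) : absIntegers 𝒪[w.adicCompletion K] (w.adicCompletion K)) ∈ absMaximalIdeal (w.adicCompletion K) := by
    rw [← hu2]
    exact Ideal.mul_mem_left _ _ hmem
  exact intCast_not_mem_absMaximalIdeal_of_odd w h2 (Int.odd_iff.mpr (by omega)) hmem2

/-! ## §3. An arithmetic Frobenius negates `√u` for `u ≡ 5 (mod 8)` when the residue field is `𝔽₂` -/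

/-- **AN ARITHMETIC FROBENIUS OF `K_w` NEGATES `√u` FOR `u ≡ 5 (mod 8)` WHEN `#𝓀(K_w) = 2`** (`w ∣ 2`, `f(w|2) = 1`, any number field `K`): for
`φ ∈ Γ_{K_w}` of Frobenius degree `1` (`φx ≡ x² (mod 𝔓)` on `\bar𝒪`), `res φ • √u = −√u` in `K̄`. Proof: `θ = (1 + ι√u)/2` satisfies `θ² = θ + c`,
`c = (u−1)/4` odd; if `φ` fixed `√u` then `φθ − θ² = −c ∈ 𝔓`, absurd. (`K_w(√u)/K_w` is the unramified quadratic extension and Frobenius generates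
its Galois group.) [cite: NeukirchANT1999, Ch. II Prop. (7.12), (7.13)] [cite: TateCorvallis1979, §1.4 (1.4.1)] -/
theorem smul_geomSqrt_eq_neg_of_isFrobPow_one_of_emod_eight_eq_five (h2 : ((2 : ℕ) : 𝓞 K) ∈ w.asIdeal)
    (hq : residueFieldCard (w.adicCompletion K) = 2) {u : ℤ} (hu : u % 8 = 5)
    {φ : absoluteGaloisGroup (w.adicCompletion K)} (hφ : IsFrobPow φ 1) :
    absGaloisRestrict K (w.adicCompletion K) φ • WeierstrassCurve.geomSqrt ((u : ℤ) : K) = -WeierstrassCurve.geomSqrt ((u : ℤ) : K) := by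
  haveI : CharZero (w.adicCompletion K) := charZero_of_injective_algebraMap (algebraMap K (w.adicCompletion K)).injective
  have hb : absClosureEmbedding K (w.adicCompletion K) (WeierstrassCurve.geomSqrt ((u : ℤ) : K)) ^ 2 =
      (u : AlgebraicClosure (w.adicCompletion K)) := absClosureEmbedding_geomSqrt_intCast_sq w u
  obtain ⟨hθint, -, hθ⟩ := isIntegral_half_one_add_of_sq_eq w (u := u) (by omega) hb
  rcases smul_geomSqrt_eq_or (absGaloisRestrict K (w.adicCompletion K) φ) ((u : ℤ) : K) with hfix | h
  swap
  · exact h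
  exfalso
  -- `φ • b = b`
  have hφb : φ • absClosureEmbedding K (w.adicCompletion K) (WeierstrassCurve.geomSqrt ((u : ℤ) : K)) =
      absClosureEmbedding K (w.adicCompletion K) (WeierstrassCurve.geomSqrt ((u : ℤ) : K)) := by
    rw [smul_absClosureEmbedding_geomSqrt, hfix]
  let xθ : absIntegers 𝒪[w.adicCompletion K] (w.adicCompletion K) :=
    ⟨(1 + absClosureEmbedding K (w.adicCompletion K) (WeierstrassCurve.geomSqrt ((u : ℤ) : K))) / 2, hθint⟩
  have hmem := (isFrobPow_natCast_iff (n := 1)).mp (by exact_mod_cast hφ) xθ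
  rw [hq, pow_one] at hmem
  -- `φ • θ = θ` and `θ² = θ + c`, so `φθ − θ² = −c`
  have hval : φ • xθ - xθ ^ 2 = -((((u - 1) / 4 : ℤ)) : absIntegers 𝒪[w.adicCompletion K] (w.adicCompletion K)) := by
    apply Subtype.ext
    change φ • ((1 + absClosureEmbedding K (w.adicCompletion K) (WeierstrassCurve.geomSqrt ((u : ℤ) : K))) / 2) -
        ((1 + absClosureEmbedding K (w.adicCompletion K) (WeierstrassCurve.geomSqrt ((u : ℤ) : K))) / 2) ^ 2 = _
    rw [absoluteGaloisGroup.smul_def, map_div₀, map_add, map_one, map_ofNat, ← absoluteGaloisGroup.smul_def, hφb, hθ]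
    push_cast
    ring
  rw [hval, neg_mem_iff] at hmem
  exact intCast_not_mem_absMaximalIdeal_of_odd w h2 (Int.odd_iff.mpr (by omega)) hmem

end Summit.BirchSwinnertonDyer.BirchSwinnertonDyer.Theorems.PrintCf2.CMPrimes

end
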